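import Summits.AtomisticToContinuum.Crystallization.Theorems.ChartedZeroExcessLayeredLatticeLiouvilleYC

/-!
# Charted zero-excess layered lattice Liouville — part YD «SparseDoor»: the OUTLOOK of part YC typed — ONE tameness-free sparse leaf [ISᵇ₀]
# closes the column (`_16XH22B₀`), and the [T]-side trio in COUNT form: `[ISᵇ₀] ⟸ [HSᵇ] ∧ [TISᵇ]`, `[HSᵇ] ⟸ [I_D] ∧ [BHSᵇ]` (PROVED), column `_16XH22Bᶜ`

Docket `stmt-AtomisticToContinuum-26636` (N = `ChartedPlanarOrder.ChartedZeroExcessLayered`), cell decomp-a2c, seat lens-2 g61 (lens «structural dichotomy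
(special vs generic)»; CRITIC-LEDGER rows 1160 (iv) «[T_bᵇ] IDEA node», 1162).

THE STRUCTURAL FACT (part UI, column `_16XH18B_tol`): the residual trio {[I_D] `DressedCorePG`, [T_bᵇ] `BareTameWindowBPG`, [W_Ψᵇ₁] `CoherentWindowPsiBPG₁`} enters
the column of record `_16XH21B₁` ONLY through the single binder (R_Wᵇ) `WildFractionBPG` — a statement about the wild MASS of SOME re-registration being
`≤ εw·η·nK(win R)`.  Part YC proved that (R_Wᵇ) follows from an `o(η)`-SPARSE incoherent-site COUNT for the given bond isomorphism, by a bond-placement lemma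
(`wildMass_le_incoherentCount`) that uses NO tameness.  Consequences typed here:
* YD-1 ★★ [ISᵇ₀] `IncoherenceSparseBPG₀ ϑ₁ ω₁ aHi Λ θ s` := part YC's [ISᵇ] with the window-tameness hypothesis DELETED (no `ϑ` at all): the `(ϑ₁, ω₁)`-incoherent
  sites of `win R` — HOT, WARM or DRIFTING alike — number `≤ εw·η·nK(win R)`.  SEAM `wildFractionBPG_of_sparse₀` (PROVED): (R_Wᵇ) ⟸ [ISᵇ₀] ALONE under
  `4ω₁ + ϑ₁ < tameRadius`; CERTIFICATE `incoherenceSparseBPG₀_of_tame_sparse` / `…_of_dressedCore_coherent₁` (PROVED): the docket of record [I_D] ∧ [T_bᵇ] ∧ [W_Ψᵇ₁]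
  implies [ISᵇ₀] — so [ISᵇ₀] is ONE leaf, WEAKER than the conjunction of the three residuals, that closes the column: ★★★ `gap_and_pert_1_50_of_certs_16XH22B₀`
  (20 generic leaves + `IncoherenceSparseBPG₀ (1/100) (1/200) 1 2 (1/16) (1/50)` + `PeriodicBulkGapDoor 2`).  What it buys: the [T]-line's SUP demand («NO bare hot
  star in win 9R», IDEA-NEEDED: source chains) is replaced by a COUNT demand (hot stars `o(η)`-sparse in win R) — a thin self-equilibrated source chain of
  length `ℓ′`, the open middle of the [T_b] docstring, costs a count only its own `ℓ′` sites.
* YD-2 ★★ THE TRIO IN COUNT FORM.  `hotCount ϑ S H Q` (sites of `Q` that are not `ϑ`-tame), `bareHotCount` (bare AND hot), `tameIncoherentCount ϑ₁ ω₁ ϑ` (tame but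
  incoherent); leaves [HSᵇ] `HotSparseBPG ϑ` (hot sites `o(η)`-sparse — the count shadow of [Tᵇ]), [BHSᵇ] `BareHotSparseBPG ϑ ϑe ωe p r₀ ℓ M` (BARE hot sites
  `o(η)`-sparse — the count shadow of [T_bᵇ], the «[T_bᵇ] IDEA node» of row 1160 (iv) in lens-2 currency), [TISᵇ] `TameIncoherenceSparseBPG ϑ₁ ω₁ ϑ` (tame-but-
  incoherent sites `o(η)`-sparse — part YC's [ISᵇ] localised to the star: the window need not be tame).  GLUE (PROVED): `incoherenceSparseBPG₀_of_hot_tameIncoherent`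
  ([ISᵇ₀] ⟸ [HSᵇ] ∧ [TISᵇ], union bound) and `hotSparseBPG_of_dressedCore_bareHot` ([HSᵇ] ⟸ [I_D] ∧ [BHSᵇ]: dressed sites are tame by [I_D], sitewise);
  CERTIFICATES (PROVED): [Tᵇ] ⇒ [HSᵇ], [T_bᵇ] ⇒ [BHSᵇ] (counts ZERO), [ISᵇ₀] ⇒ [TISᵇ] (sub-count); ★★★ column `gap_and_pert_1_50_of_certs_16XH22Bᶜ` ([I_D] kept,
  [T_bᵇ] ↦ [BHSᵇ], [W_Ψᵇ₁] ↦ [TISᵇ]) and `bareHotSparse_and_tameIncoherenceSparse_of_record` (docket of record ⇒ count docket, PROVED).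
HONEST PLACEMENT.  [TISᵇ] with STAR-wise tameness is the natural union-bound partner but its (M)-type mechanism (Caccioppoli modulo rigid motions needs the
chart re-fitted on a BALL) wants BALL-wise tameness around the site; the foreseen second layer is `[TISᵇ] ⟸ [HSᵇ-on-win 2R] ⊕ «incoherent sites with an r-tame
ball are sparse»` (a hot site spoils `≤ (2r/δ+1)³` balls).  [BHSᵇ]'s mechanism is [T_b]'s (e⋆-GSC replacement of fat bare hot regions over `UniformTameStability`)
MINUS the thin-chain sub-case, which a count absorbs as long as chains have total length `o(η·nK)` per window — an `L^p`, `p < ∞`, demand in place of `L^∞`.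
No proof holes, no new axiom, no instances, no notations, no option overrides.
-/

noncomputable section

open scoped BigOperators Classical
open MeasureTheory Set Metric Filter Topology
open Summit.AtomisticToContinuum.Crystallization.Theorems.ChartedPlanarOrderRigidityDoor (E3 atomsIn VisibleGap PertRegime)
open Summit.AtomisticToContinuum.Crystallization.Theorems.ChartedPlanarOrderDensityDichotomy (μS IsSep nK nK_nonneg)
open Summit.AtomisticToContinuum.Crystallization.Theorems.ChartedPlanarOrderCleanScaleP (IsCleanP IsDoorSetP)
open Summit.AtomisticToContinuum.Crystallization.Theorems.ChartedPlanarOrderMesoCut (LayeredHom EnvClose)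
open Summit.AtomisticToContinuum.Crystallization.Theorems.ChartedPlanarOrderDoorLayered (atomsIn_subset sq_le_finsum_mem PeriodicBulkGapDoor)
open Summit.AtomisticToContinuum.Crystallization.Theorems.ChartedPlanarOrderDoorLayeredOsc (IsTwoShellAffineGood)

namespace Summit.AtomisticToContinuum.Crystallization.Theorems.ChartedZeroExcessLayeredLatticeLiouville

/-! ### YD-1  The tameness-free sparse leaf [ISᵇ₀] and the one-binder column `_16XH22B₀` -/

/-- ★★ **[ISᵇ₀] «IncoherenceSparseBPG₀ ϑ₁ ω₁ aHi Λ θ s» — INCOHERENT SITES ARE `o(η)`-SPARSE, NO TAMENESS ASSUMED.**  Part YC's [ISᵇ] `IncoherenceSparseBPG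
ϑ₁ ω₁ ϑ` VERBATIM with the hypothesis `IsTameOn ϑ S H (win 9R)` deleted: for bond-isomorphic `(Cg, η, R)`-registered `Ψ` into an equilibrium `s`-chart on a
`K₀`-fat θ-good near-flat GSC door window, the sites of `win R` that are NOT `(ϑ₁, ω₁)`-coherent for `Ψ` (hot, warm or drifting) number `≤ εw·η·nK(win R)`
(`η ≤ η₁(εw, K₀, …)`, `R ≥ R₁`).  ONE LEAF REPLACING THE TRIO: (R_Wᵇ) ⟸ [ISᵇ₀] alone (`wildFractionBPG_of_sparse₀`, PROVED, side condition `4ω₁ + ϑ₁ <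
tameRadius`), and [I_D] ∧ [T_bᵇ] ∧ [W_Ψᵇ₁] ⇒ [Tᵇ] ∧ [ISᵇ] ⇒ [ISᵇ₀] (PROVED) — WEAKER than the docket of record as a conjunction, STRONGER than [ISᵇ] alone
(`incoherenceSparseBPG_of_sparse₀`).  The [T]-line's sup demand becomes a count demand (cut in YD-2).  Mechanism: the (K) ∧ (M) currencies of parts TR/UI for
the given `Ψ` (part YC `incoherentCount_le_of_tiltStrainData`: `#incoherent ≤ Σσ³/ϑ₁³ + Σtilt³/ω₁³`), whose statements carry no tameness either — tameness
re-enters only inside (M)'s proof (re-fitting chart patches on balls), i.e. as [HSᵇ] of YD-2, not as a sup-norm leaf.  NEW as a typed leaf · GSC-priced ·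
UNDECIDED(stated test: census (F1) «CoherenceScan» incoherent column incl. hot sites, per window against `η·nK`) · INSTRUMENTABLE · ATTACKABLE·L given [HSᵇ].
Why it might fail: hot spots / warm lenses / source chains at spatial density `≍ η` (each `O(1)` sites) saturate the count — exactly (R_Wᵇ)'s failure mode,
nothing sparser threatens it; kinematics alone gives only `O(η)` (part YC `incoherentCount_le_of_dom_sq`).
Sources: part YC ([ISᵇ], seam, Chebyshev shadows); parts TR/UI ((K), (M), (Mᵇ), (R_Wᵇ)); part UC ([T]); CRITIC-LEDGER row 1160. [this file, g61] -/
def IncoherenceSparseBPG₀ (ϑ₁ ω₁ aHi Λ θ s : ℝ) : Prop :=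
  ∀ δ : ℝ, 0 < δ → ∀ a : ℝ, 0 < a → ∀ Cg : ℝ, 1 ≤ Cg →
    ∀ εw : ℝ, 0 < εw → ∀ K₀ : ℝ, 0 < K₀ → ∃ η₁ : ℝ, 0 < η₁ ∧ ∃ R₁ : ℝ, 0 < R₁ ∧
      ∀ S : Set E3, IsDoorSetPG aHi δ S → (∀ q ∈ S, IsTwoShellAffineGood θ S q) →
        ∀ η : ℝ, 0 < η → η ≤ η₁ → ∀ R : ℝ, R₁ ≤ R →
          ∀ (L : E3 ≃L[ℝ] E3) (w : ℤ → E3), IsEquilChart a s Λ L w →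
            ∀ Ψ : E3 → E3, IsGlobalReg Cg η R S (LayeredHom (L : E3 →L[ℝ] E3) w) Ψ → IsBondIso S Ψ →
              K₀ ≤ η * nK (atomsIn (μS S) 0 R) →
                incoherentCount ϑ₁ ω₁ S Ψ (atomsIn (μS S) 0 R) ≤ εw * η * nK (atomsIn (μS S) 0 R)

/-- **[ISᵇ₀] ⇒ [ISᵇ](ϑ) for every `ϑ` (PROVED)** — the tameness hypothesis is simply not used. [this file, g61] -/
theorem incoherenceSparseBPG_of_sparse₀ {ϑ₁ ω₁ ϑ aHi Λ θ s : ℝ} (h : IncoherenceSparseBPG₀ ϑ₁ ω₁ aHi Λ θ s) :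
    IncoherenceSparseBPG ϑ₁ ω₁ ϑ aHi Λ θ s := by
  intro δ hδ a ha Cg hCg εw hεw K₀ hK₀
  obtain ⟨η₁, hη₁, R₁, hR₁, h1⟩ := h δ hδ a ha Cg hCg εw hεw K₀ hK₀
  exact ⟨η₁, hη₁, R₁, hR₁, fun S hS hgood η hη hηle R hR L w hLw Ψ hΨ hBI hfat _ => h1 S hS hgood η hη hηle R hR L w hLw Ψ hΨ hBI hfat⟩

/-- **[Tᵇ](ϑ) ∧ [ISᵇ](ϑ) ⇒ [ISᵇ₀] (PROVED)** — feed the window tameness from [Tᵇ] (`η₁ := min`, `R₁ := max`). [this file, g61] -/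
theorem incoherenceSparseBPG₀_of_tame_sparse {ϑ₁ ω₁ ϑ aHi Λ θ s : ℝ} (hT : TameWindowBPG ϑ aHi Λ θ s) (hIS : IncoherenceSparseBPG ϑ₁ ω₁ ϑ aHi Λ θ s) :
    IncoherenceSparseBPG₀ ϑ₁ ω₁ aHi Λ θ s := by
  intro δ hδ a ha Cg hCg εw hεw K₀ hK₀
  obtain ⟨η₂, hη₂, R₂, hR₂, h2⟩ := hT δ hδ a ha Cg hCg K₀ hK₀
  obtain ⟨η₃, hη₃, R₃, hR₃, h3⟩ := hIS δ hδ a ha Cg hCg εw hεw K₀ hK₀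
  refine ⟨min η₂ η₃, lt_min hη₂ hη₃, max R₂ R₃, lt_max_of_lt_left hR₂, ?_⟩
  intro S hS hgood η hη hηle R hR L w hLw Ψ hΨ hBI hfat
  exact h3 S hS hgood η hη (hηle.trans (min_le_right _ _)) R ((le_max_right _ _).trans hR) L w hLw Ψ hΨ hBI hfat
    (h2 S hS hgood η hη (hηle.trans (min_le_left _ _)) R ((le_max_left _ _).trans hR) L w hLw Ψ hΨ hBI hfat)

/-- **[Tᵇ](ϑ) ∧ [W_Ψᵇ₁|c](ϑ₁, ω₁, ϑ) ⇒ [ISᵇ₀] for every `c ≥ 1` (PROVED)**. [this file, g61] -/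
theorem incoherenceSparseBPG₀_of_tame_coherentAt {c ϑ₁ ω₁ ϑ aHi Λ θ s : ℝ} (hc : 1 ≤ c) (hT : TameWindowBPG ϑ aHi Λ θ s)
    (hW : CoherentWindowPsiBPGAt c ϑ₁ ω₁ ϑ aHi Λ θ s) : IncoherenceSparseBPG₀ ϑ₁ ω₁ aHi Λ θ s :=
  incoherenceSparseBPG₀_of_tame_sparse hT (incoherenceSparseBPG_of_coherentAt hc hW)

/-- **THE DOCKET OF RECORD ⇒ [ISᵇ₀] (PROVED)**: [I_D] ∧ [T_bᵇ] ∧ [W_Ψᵇ₁](ϑ₁, ω₁) at threshold `ϑ` give [ISᵇ₀](ϑ₁, ω₁) — no side condition. [this file, g61] -/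
theorem incoherenceSparseBPG₀_of_dressedCore_coherent₁ {ϑ₁ ω₁ ϑ ϑe ωe : ℝ} {p : ℕ} {r₀ ℓ : ℝ} {M : ℕ} {aHi Λ θ s : ℝ}
    (hI : DressedCorePG ϑ ϑe ωe p r₀ ℓ M aHi Λ θ s) (hTb : BareTameWindowBPG ϑ ϑe ωe p r₀ ℓ M aHi Λ θ s)
    (hW : CoherentWindowPsiBPG₁ ϑ₁ ω₁ ϑ aHi Λ θ s) : IncoherenceSparseBPG₀ ϑ₁ ω₁ aHi Λ θ s :=
  incoherenceSparseBPG₀_of_tame_coherentAt (by norm_num) (tameWindowBPG_of_dressedCore_of_bare hI hTb)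
    ((coherentWindowPsiBPGAt_nine_iff).2 hW)

/-- ★★ **SEAM (PROVED): (R_Wᵇ) ⟸ [ISᵇ₀] ALONE** under `4·ω₁ + ϑ₁ < tameRadius` — `Ψ' := Ψ`, `Cg' := Cg`; the bond placement `wildMass_le_incoherentCount` of
part YC needs only `δ`-separation (door) and tear-freeness (registration), never tameness. [this file, g61] -/
theorem wildFractionBPG_of_sparse₀ {ϑ₁ ω₁ aHi Λ θ s : ℝ} (hside : 4 * ω₁ + ϑ₁ < tameRadius) (h : IncoherenceSparseBPG₀ ϑ₁ ω₁ aHi Λ θ s) :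
    WildFractionBPG aHi Λ θ s := by
  intro δ hδ a ha Cg hCg
  refine ⟨Cg, le_rfl, fun εw hεw K₀ hK₀ => ?_⟩
  have hN : (0 : ℝ) < 144 * (2 * 4 / δ + 1) ^ 3 := by positivity
  obtain ⟨η₁, hη₁, R₁, hR₁, h1⟩ := h δ hδ a ha Cg hCg (εw / (144 * (2 * 4 / δ + 1) ^ 3)) (div_pos hεw hN) K₀ hK₀
  refine ⟨η₁, hη₁, R₁, hR₁, ?_⟩
  intro S hS hgood η hη hηle R hR L w hLw Ψ hΨ hBI hfat
  have hcnt := h1 S hS hgood η hη hηle R hR L w hLw Ψ hΨ hBI hfat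
  refine ⟨Ψ, hΨ, ?_⟩
  calc wildMass tameRadius (atomsIn (μS S) 0 R) Ψ
      ≤ 144 * (2 * 4 / δ + 1) ^ 3 * incoherentCount ϑ₁ ω₁ S Ψ (atomsIn (μS S) 0 R) :=
        wildMass_le_incoherentCount hδ hS.1.2.1 hΨ.2.1 hside
    _ ≤ 144 * (2 * 4 / δ + 1) ^ 3 * (εw / (144 * (2 * 4 / δ + 1) ^ 3) * η * nK (atomsIn (μS S) 0 R)) :=
        mul_le_mul_of_nonneg_left hcnt hN.le
    _ = εw * η * nK (atomsIn (μS S) 0 R) := by field_simp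

/-- ★★★ **COLUMN `_16XH22B₀`** — `_16XH21B₁` with the WHOLE residual trio {[I_D], [T_bᵇ], [W_Ψᵇ₁]} replaced by the ONE tameness-free sparse leaf
[ISᵇ₀](1/100, 1/200): 20 generic leaves + `IncoherenceSparseBPG₀ (1/100) (1/200) 1 2 (1/16) (1/50)` + `PeriodicBulkGapDoor 2` ⇒ `VisibleGap (1/50) ∧ PertRegime
(1/50)`.  The hypothesis is implied by the three it replaces (`incoherenceSparseBPG₀_of_dressedCore_coherent₁`, PROVED). [this file, g61] -/
theorem gap_and_pert_1_50_of_certs_16XH22B₀ (hL : LatticeLiouvilleCert) (hL' : LayeredLiouvilleCert)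
    (hR : OscRigidityL2BDPG 1 2 (1 / 16) (1 / 16)) (hX : ExcessFlatnessControlP 1 2 (1 / 16) (1 / 16))
    (hE : ExcessChartLocalisationP 1 2 (1 / 16) (1 / 100)) (hP : RegistrationP 1 2 (1 / 16) (1 / 100))
    (hT : TailDominationCert) (hU : UniformTameStabilityE (1 / 50) 2 (1 / 2000))
    (h1 : WordTransplantP 1 2 (1 / 16) (1 / 100)) (hGT : GradReframingThickP 1 2 (1 / 16) (1 / 100) (1 / 50))
    (hΛ0 : LaunderingAprioriPX 1 2 (1 / 16) (1 / 100) (1 / 50)) (hΛs : LaunderingStepPX 1 2 (1 / 16) (1 / 100) (1 / 50))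
    (hUc : UntwistCollarP 1 2 (1 / 16) (1 / 50))
    (hl : BondIsoLevelsP 1 2 (1 / 16) (1 / 50)) (hN : EnergyNearChartPX 1 2 (1 / 16) (1 / 50) (1 / 2000))
    (hF : TailForceSlavingP 1 2 (1 / 16) (1 / 50))
    (hE' : LipDualLinearisationP 1 2 (1 / 16) (1 / 50)) (hA : L2HarmonicApproxPE 1 2 (1 / 16) (1 / 50) (1 / 2000))
    (hD : PositionDecayPLE 1 2 (1 / 16) (1 / 50) (1 / 2000)) (hC : PositionCaccioppoliPGE 1 2 (1 / 16) (1 / 50) (1 / 2000))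
    (hIS₀ : IncoherenceSparseBPG₀ (1 / 100) (1 / 200) 1 2 (1 / 16) (1 / 50))
    (hG : PeriodicBulkGapDoor 2) : VisibleGap (1 / 50) ∧ PertRegime (1 / 50) :=
  gap_and_pert_1_50_of_certs_16XH18B_tol hL hL' hR hX hE hP hT hU h1 hGT hΛ0 hΛs hUc (untwistBookkeepingP_one 2 (1 / 50)) hl hN hF hE' hA hD hC
    (wildFractionBPG_of_sparse₀ (by norm_num [tameRadius]) hIS₀) hG

/-! ### YD-2  The [T]-side trio in COUNT form: [ISᵇ₀] ⟸ [HSᵇ] ∧ [TISᵇ], [HSᵇ] ⟸ [I_D] ∧ [BHSᵇ] -/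

/-- number of sites of `Q` that are NOT `ϑ`-tame (classical indicator). [this file, g61] -/
def hotCount (ϑ : ℝ) (S H Q : Set E3) : ℝ :=
  ∑ᶠ x ∈ Q, if IsTameStar ϑ S H x then (0 : ℝ) else 1

/-- number of sites of `Q` that are BARE (not `(ϑe, ωe, p, r₀, ℓ, M)`-dressed) AND not `ϑ`-tame. [this file, g61] -/
def bareHotCount (ϑ ϑe ωe : ℝ) (p : ℕ) (r₀ ℓ : ℝ) (M : ℕ) (S H Q : Set E3) : ℝ :=
  ∑ᶠ x ∈ Q, if IsDressed ϑe ωe p r₀ ℓ M S H x ∨ IsTameStar ϑ S H x then (0 : ℝ) else 1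

/-- number of sites of `Q` that are `ϑ`-tame but NOT `(ϑ₁, ω₁)`-coherent for `Ψ`. [this file, g61] -/
def tameIncoherentCount (ϑ₁ ω₁ ϑ : ℝ) (S H : Set E3) (Ψ : E3 → E3) (Q : Set E3) : ℝ :=
  ∑ᶠ x ∈ Q, if IsTameStar ϑ S H x ∧ ¬ IsCoherentBy ϑ₁ ω₁ S Ψ {x} then (1 : ℝ) else 0

/-- `hotCount_nonneg` (docstring added by the landing lane; see the module docstring). [formal bookkeeping] -/
theorem hotCount_nonneg (ϑ : ℝ) (S H Q : Set E3) : 0 ≤ hotCount ϑ S H Q :=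
  finsum_nonneg fun x => finsum_nonneg fun _ => by split_ifs <;> norm_num

/-- `bareHotCount_nonneg` (docstring added by the landing lane; see the module docstring). [formal bookkeeping] -/
theorem bareHotCount_nonneg (ϑ ϑe ωe : ℝ) (p : ℕ) (r₀ ℓ : ℝ) (M : ℕ) (S H Q : Set E3) : 0 ≤ bareHotCount ϑ ϑe ωe p r₀ ℓ M S H Q :=
  finsum_nonneg fun x => finsum_nonneg fun _ => by split_ifs <;> norm_num

/-- `tameIncoherentCount_nonneg` (docstring added by the landing lane; see the module docstring). [formal bookkeeping] -/
theorem tameIncoherentCount_nonneg (ϑ₁ ω₁ ϑ : ℝ) (S H : Set E3) (Ψ : E3 → E3) (Q : Set E3) : 0 ≤ tameIncoherentCount ϑ₁ ω₁ ϑ S H Ψ Q :=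
  finsum_nonneg fun x => finsum_nonneg fun _ => by split_ifs <;> norm_num

/-- union bound: incoherent ⊆ hot ∪ (tame ∧ incoherent) (PROVED). [this file, g61] -/
theorem incoherentCount_le_hot_add_tameIncoherent {ϑ₁ ω₁ ϑ : ℝ} {S H Q : Set E3} {Ψ : E3 → E3} (hQ : Q.Finite) :
    incoherentCount ϑ₁ ω₁ S Ψ Q ≤ hotCount ϑ S H Q + tameIncoherentCount ϑ₁ ω₁ ϑ S H Ψ Q := by
  rw [incoherentCount, hotCount, tameIncoherentCount, finsum_mem_eq_finite_toFinset_sum _ hQ, finsum_mem_eq_finite_toFinset_sum _ hQ,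
    finsum_mem_eq_finite_toFinset_sum _ hQ, ← Finset.sum_add_distrib]
  refine Finset.sum_le_sum fun x _ => ?_
  by_cases h1 : IsCoherentBy ϑ₁ ω₁ S Ψ {x}
  · rw [if_pos h1]
    have ha : (0 : ℝ) ≤ (if IsTameStar ϑ S H x then (0 : ℝ) else 1) := by split_ifs <;> norm_num
    have hb : (0 : ℝ) ≤ (if IsTameStar ϑ S H x ∧ ¬ IsCoherentBy ϑ₁ ω₁ S Ψ {x} then (1 : ℝ) else 0) := by split_ifs <;> norm_num
    exact add_nonneg ha hb
  · rw [if_neg h1]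
    by_cases h2 : IsTameStar ϑ S H x
    · rw [if_pos h2, if_pos ⟨h2, h1⟩]; norm_num
    · rw [if_neg h2, if_neg (fun h' => h2 h'.1)]; norm_num

/-- hot ⊆ bare-hot once dressed sites are tame (PROVED). [this file, g61] -/
theorem hotCount_le_bareHotCount {ϑ ϑe ωe : ℝ} {p : ℕ} {r₀ ℓ : ℝ} {M : ℕ} {S H Q : Set E3} (hQ : Q.Finite)
    (hdress : ∀ x ∈ Q, IsDressed ϑe ωe p r₀ ℓ M S H x → IsTameStar ϑ S H x) :
    hotCount ϑ S H Q ≤ bareHotCount ϑ ϑe ωe p r₀ ℓ M S H Q := by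
  rw [hotCount, bareHotCount, finsum_mem_eq_finite_toFinset_sum _ hQ, finsum_mem_eq_finite_toFinset_sum _ hQ]
  refine Finset.sum_le_sum fun x hx => ?_
  have hxQ : x ∈ Q := hQ.mem_toFinset.1 hx
  by_cases ht : IsTameStar ϑ S H x
  · rw [if_pos ht, if_pos (Or.inr ht)]
  · have hnd : ¬ IsDressed ϑe ωe p r₀ ℓ M S H x := fun hd => ht (hdress x hxQ hd)
    rw [if_neg ht, if_neg (fun h' => h'.elim hnd ht)]

/-- `hotCount_eq_zero_of_isTameOn` (docstring added by the landing lane; see the module docstring). [formal bookkeeping] -/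
theorem hotCount_eq_zero_of_isTameOn {ϑ : ℝ} {S H Q K : Set E3} (h : IsTameOn ϑ S H K) (hQ : Q ⊆ K) : hotCount ϑ S H Q = 0 := by
  refine finsum_mem_of_eqOn_zero fun x hx => ?_
  show (if IsTameStar ϑ S H x then (0 : ℝ) else 1) = 0
  rw [if_pos (h x (hQ hx))]

/-- `bareHotCount_eq_zero_of_bare_tame` (docstring added by the landing lane; see the module docstring). [formal bookkeeping] -/
theorem bareHotCount_eq_zero_of_bare_tame {ϑ ϑe ωe : ℝ} {p : ℕ} {r₀ ℓ : ℝ} {M : ℕ} {S H Q : Set E3}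
    (h : ∀ x ∈ Q, ¬ IsDressed ϑe ωe p r₀ ℓ M S H x → IsTameStar ϑ S H x) : bareHotCount ϑ ϑe ωe p r₀ ℓ M S H Q = 0 := by
  refine finsum_mem_of_eqOn_zero fun x hx => ?_
  show (if IsDressed ϑe ωe p r₀ ℓ M S H x ∨ IsTameStar ϑ S H x then (0 : ℝ) else 1) = 0
  by_cases hd : IsDressed ϑe ωe p r₀ ℓ M S H x
  · rw [if_pos (Or.inl hd)]
  · rw [if_pos (Or.inr (h x hx hd))]

/-- `tameIncoherentCount_le_incoherentCount` (docstring added by the landing lane; see the module docstring). [formal bookkeeping] -/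
theorem tameIncoherentCount_le_incoherentCount {ϑ₁ ω₁ ϑ : ℝ} {S H Q : Set E3} {Ψ : E3 → E3} (hQ : Q.Finite) :
    tameIncoherentCount ϑ₁ ω₁ ϑ S H Ψ Q ≤ incoherentCount ϑ₁ ω₁ S Ψ Q := by
  rw [tameIncoherentCount, incoherentCount, finsum_mem_eq_finite_toFinset_sum _ hQ, finsum_mem_eq_finite_toFinset_sum _ hQ]
  refine Finset.sum_le_sum fun x _ => ?_
  by_cases h1 : IsCoherentBy ϑ₁ ω₁ S Ψ {x}
  · rw [if_neg (fun h' => h'.2 h1), if_pos h1]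
  · rw [if_neg h1]; split_ifs <;> norm_num

/-- ★★ **[HSᵇ] «HotSparseBPG ϑ aHi Λ θ s» — HOT STARS ARE `o(η)`-SPARSE** (the COUNT SHADOW of [Tᵇ] `TameWindowBPG ϑ`): with [ISᵇ₀]'s binders (no tameness
assumed anywhere), the sites of `win R` that are not `ϑ`-tame number `≤ εw·η·nK(win R)`.  WEAKER than [Tᵇ] (`hotSparseBPG_of_tameWindowBPG`, PROVED: the count is
ZERO) and cut as [I_D] ∧ [BHSᵇ] (`hotSparseBPG_of_dressedCore_bareHot`, PROVED).  Registration-blind in its conclusion (`Ψ` enters the hypotheses only).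
Mechanism: [T]'s size dichotomy with the thin/mesoscopic middle DEMOTED from «absent» to «short in total»: FAT hot regions by e⋆-GSC volume-vs-surface over
`UniformTameStability` (part TP), ISOLATED hot cores are dressed ([I_D]), CHAINS need only total length `o(η·nK(win R))`.  NEW · GSC-priced · UNDECIDED(stated
test: census (F0) «HotStarScan» count column per window against `η·nK`) · INSTRUMENTABLE · IDEA-NAMED (count form of [T]'s dichotomy).
Why it might fail: a density `≍ η` of self-equilibrated source chains of bounded length — [T]'s inhabitant candidate, now required only to be RARE, not absent;
none known for Lennard-Jones close packings, none seen in the census.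
Sources: part UC ([T]: Ehrlacher–Ortner–Shapeev, Arch. Ration. Mech. Anal. 222 (2016) 1217; Theil, Comm. Math. Phys. 262 (2006) 209; Flatley–Theil,
arXiv 1407.0692; E–Ming, Arch. Ration. Mech. Anal. 183 (2007) 241); part UK ([Tᵇ]); Braun–Hudson–Ortner, arXiv 2108.04765; CRITIC-LEDGER row 1160 (iv). [this file, g61] -/
def HotSparseBPG (ϑ aHi Λ θ s : ℝ) : Prop :=
  ∀ δ : ℝ, 0 < δ → ∀ a : ℝ, 0 < a → ∀ Cg : ℝ, 1 ≤ Cg →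
    ∀ εw : ℝ, 0 < εw → ∀ K₀ : ℝ, 0 < K₀ → ∃ η₁ : ℝ, 0 < η₁ ∧ ∃ R₁ : ℝ, 0 < R₁ ∧
      ∀ S : Set E3, IsDoorSetPG aHi δ S → (∀ q ∈ S, IsTwoShellAffineGood θ S q) →
        ∀ η : ℝ, 0 < η → η ≤ η₁ → ∀ R : ℝ, R₁ ≤ R →
          ∀ (L : E3 ≃L[ℝ] E3) (w : ℤ → E3), IsEquilChart a s Λ L w →
            ∀ Ψ : E3 → E3, IsGlobalReg Cg η R S (LayeredHom (L : E3 →L[ℝ] E3) w) Ψ → IsBondIso S Ψ →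
              K₀ ≤ η * nK (atomsIn (μS S) 0 R) →
                hotCount ϑ S (LayeredHom (L : E3 →L[ℝ] E3) w) (atomsIn (μS S) 0 R) ≤ εw * η * nK (atomsIn (μS S) 0 R)

/-- ★★ **[BHSᵇ] «BareHotSparseBPG ϑ ϑe ωe p r₀ ℓ M aHi Λ θ s» — BARE HOT STARS ARE `o(η)`-SPARSE** (the COUNT SHADOW of [T_bᵇ] `BareTameWindowBPG`, = the
«[T_bᵇ] IDEA node» of CRITIC-LEDGER row 1160 (iv) in lens-2 currency): with [ISᵇ₀]'s binders, the sites of `win R` that are BARE (`¬ IsDressed ϑe ωe p r₀ ℓ M`,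
part UG: no container of `≤ M` sites around them with an `(r₀, ℓ)`-moat under the `(ϑe, ωe, p)`-envelope) AND not `ϑ`-tame number `≤ εw·η·nK(win R)`.  WEAKER
than [T_bᵇ] (`bareHotSparseBPG_of_bareTame`, PROVED: count ZERO); with [I_D] it gives [HSᵇ] (PROVED).  What the count form buys against [T_b]'s IDEA-NEEDED
«SOURCE CHAINS» (super-elastic sources of `r₀`-domination number `> M`, `ℓ`-linked; fat sub-class by volume-vs-surface, THIN CHAINS OPEN): a thin chain is no
longer an inhabitant unless chains occupy a fraction `≳ εw·η` of the window — the demand drops from `L^∞` («no bare hot star») to `L¹`-small («few»), which is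
the natural output of an e⋆-GSC energy budget (each bare hot star that is part of a fat region costs `≥ c₀` by `UniformTameStability`; a chain of `N` linked
sources costs `≥ c₁·N` if sources do not screen each other — the one IDEA-NEEDED point, now quantitative rather than absolute).  NEW · GSC-priced · UNDECIDED
(stated test: census (F0g) «DressScan», count of the quadrant `{hot, M_dr(x) > 12}` per window against `η·nK`; prediction `0` in defect-free relaxed windows,
`≤ 13·#cores` in defected ones) · INSTRUMENTABLE · IDEA-NAMED (additive source cost) · ATTACKABLE·M on the fat sub-class.
Why it might fail: mutually SCREENING source chains (a self-equilibrated multipole chain whose far field cancels, so that its e⋆-excess is not additive in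
its length) at density `≍ η`; none known, none seen.
Sources: part UG ([T_b], [I_D], `exists_superEnvelope_of_not_isDressed`); part UK ([T_bᵇ]); part TP (`UniformTameStability`); Braun–Hudson–Ortner, arXiv
2108.04765 (multipole far fields of lattice defects); Ehrlacher–Ortner–Shapeev 2016; CRITIC-LEDGER row 1160 (iv). [this file, g61] -/
def BareHotSparseBPG (ϑ ϑe ωe : ℝ) (p : ℕ) (r₀ ℓ : ℝ) (M : ℕ) (aHi Λ θ s : ℝ) : Prop :=
  ∀ δ : ℝ, 0 < δ → ∀ a : ℝ, 0 < a → ∀ Cg : ℝ, 1 ≤ Cg →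
    ∀ εw : ℝ, 0 < εw → ∀ K₀ : ℝ, 0 < K₀ → ∃ η₁ : ℝ, 0 < η₁ ∧ ∃ R₁ : ℝ, 0 < R₁ ∧
      ∀ S : Set E3, IsDoorSetPG aHi δ S → (∀ q ∈ S, IsTwoShellAffineGood θ S q) →
        ∀ η : ℝ, 0 < η → η ≤ η₁ → ∀ R : ℝ, R₁ ≤ R →
          ∀ (L : E3 ≃L[ℝ] E3) (w : ℤ → E3), IsEquilChart a s Λ L w →
            ∀ Ψ : E3 → E3, IsGlobalReg Cg η R S (LayeredHom (L : E3 →L[ℝ] E3) w) Ψ → IsBondIso S Ψ →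
              K₀ ≤ η * nK (atomsIn (μS S) 0 R) →
                bareHotCount ϑ ϑe ωe p r₀ ℓ M S (LayeredHom (L : E3 →L[ℝ] E3) w) (atomsIn (μS S) 0 R) ≤ εw * η * nK (atomsIn (μS S) 0 R)

/-- ★★ **[TISᵇ] «TameIncoherenceSparseBPG ϑ₁ ω₁ ϑ aHi Λ θ s» — TAME-BUT-INCOHERENT STARS ARE `o(η)`-SPARSE** (part YC's [ISᵇ] LOCALISED to the star: the
window need not be tame; only the `ϑ`-tame sites of `win R` that fail `(ϑ₁, ω₁)`-coherence for `Ψ` are counted).  WEAKER than [ISᵇ₀] (sub-count, PROVED), hence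
than the docket of record; with [HSᵇ] it gives [ISᵇ₀] back (union bound, PROVED).  Mechanism: as [WSᵇ] ∧ [DSᵇ] of part YC (the (M)/(K) currencies for the
given `Ψ`), with ONE honest caveat: (M)'s Caccioppoli step re-fits chart patches on BALLS, so it wants the star's NEIGHBOURHOOD tame, not just the star — the
foreseen second layer is «incoherent sites with an `r`-tame ball are sparse» ⊕ [HSᵇ] on `win 2R` (a hot site spoils `≤ (2r/δ+1)³` balls; `nK(win 2R) ≤ C·nK(win R)`
on fat door windows).  NEW as a typed leaf · GSC-priced · UNDECIDED((F1) «CoherenceScan» restricted to tame sites) · INSTRUMENTABLE · ATTACKABLE·L modulo the caveat.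
Why it might fail: as [ISᵇ]/(R_Wᵇ) (warm lenses / hot-spot halos at density `≍ η`); plus the caveat — incoherent TAME stars bordering hot regions are charged
here, and are as numerous as hot-region boundaries (`≲ #hot·12`, so still governed by [HSᵇ]).
Sources: part YC ([ISᵇ], [WSᵇ], [DSᵇ]); parts TR/UI ((K), (M)); CRITIC-LEDGER row 1160. [this file, g61] -/
def TameIncoherenceSparseBPG (ϑ₁ ω₁ ϑ aHi Λ θ s : ℝ) : Prop :=
  ∀ δ : ℝ, 0 < δ → ∀ a : ℝ, 0 < a → ∀ Cg : ℝ, 1 ≤ Cg →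
    ∀ εw : ℝ, 0 < εw → ∀ K₀ : ℝ, 0 < K₀ → ∃ η₁ : ℝ, 0 < η₁ ∧ ∃ R₁ : ℝ, 0 < R₁ ∧
      ∀ S : Set E3, IsDoorSetPG aHi δ S → (∀ q ∈ S, IsTwoShellAffineGood θ S q) →
        ∀ η : ℝ, 0 < η → η ≤ η₁ → ∀ R : ℝ, R₁ ≤ R →
          ∀ (L : E3 ≃L[ℝ] E3) (w : ℤ → E3), IsEquilChart a s Λ L w →
            ∀ Ψ : E3 → E3, IsGlobalReg Cg η R S (LayeredHom (L : E3 →L[ℝ] E3) w) Ψ → IsBondIso S Ψ →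
              K₀ ≤ η * nK (atomsIn (μS S) 0 R) →
                tameIncoherentCount ϑ₁ ω₁ ϑ S (LayeredHom (L : E3 →L[ℝ] E3) w) Ψ (atomsIn (μS S) 0 R) ≤ εw * η * nK (atomsIn (μS S) 0 R)

/-- ★★ **GLUE (PROVED): [HSᵇ](ϑ) ∧ [TISᵇ](ϑ₁, ω₁, ϑ) ⇒ [ISᵇ₀](ϑ₁, ω₁)** (`εw/2` each, union bound). [this file, g61] -/
theorem incoherenceSparseBPG₀_of_hot_tameIncoherent {ϑ₁ ω₁ ϑ aHi Λ θ s : ℝ} (hH : HotSparseBPG ϑ aHi Λ θ s)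
    (hT : TameIncoherenceSparseBPG ϑ₁ ω₁ ϑ aHi Λ θ s) : IncoherenceSparseBPG₀ ϑ₁ ω₁ aHi Λ θ s := by
  intro δ hδ a ha Cg hCg εw hεw K₀ hK₀
  obtain ⟨η₂, hη₂, R₂, hR₂, h2⟩ := hH δ hδ a ha Cg hCg (εw / 2) (half_pos hεw) K₀ hK₀
  obtain ⟨η₃, hη₃, R₃, hR₃, h3⟩ := hT δ hδ a ha Cg hCg (εw / 2) (half_pos hεw) K₀ hK₀
  refine ⟨min η₂ η₃, lt_min hη₂ hη₃, max R₂ R₃, lt_max_of_lt_left hR₂, ?_⟩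
  intro S hS hgood η hη hηle R hR L w hLw Ψ hΨ hBI hfat
  have ha := h2 S hS hgood η hη (hηle.trans (min_le_left _ _)) R ((le_max_left _ _).trans hR) L w hLw Ψ hΨ hBI hfat
  have hb := h3 S hS hgood η hη (hηle.trans (min_le_right _ _)) R ((le_max_right _ _).trans hR) L w hLw Ψ hΨ hBI hfat
  calc incoherentCount ϑ₁ ω₁ S Ψ (atomsIn (μS S) 0 R)
      ≤ hotCount ϑ S (LayeredHom (L : E3 →L[ℝ] E3) w) (atomsIn (μS S) 0 R)
          + tameIncoherentCount ϑ₁ ω₁ ϑ S (LayeredHom (L : E3 →L[ℝ] E3) w) Ψ (atomsIn (μS S) 0 R) :=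
        incoherentCount_le_hot_add_tameIncoherent (finite_atomsIn hδ hS.1.2.1 R)
    _ ≤ εw / 2 * η * nK (atomsIn (μS S) 0 R) + εw / 2 * η * nK (atomsIn (μS S) 0 R) := add_le_add ha hb
    _ = εw * η * nK (atomsIn (μS S) 0 R) := by ring

/-- ★★ **GLUE (PROVED): [I_D] ∧ [BHSᵇ] ⇒ [HSᵇ]** — dressed sites are `ϑ`-tame by [I_D] (sitewise, window data unused), so hot ⊆ bare-hot. [this file, g61] -/
theorem hotSparseBPG_of_dressedCore_bareHot {ϑ ϑe ωe : ℝ} {p : ℕ} {r₀ ℓ : ℝ} {M : ℕ} {aHi Λ θ s : ℝ}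
    (hI : DressedCorePG ϑ ϑe ωe p r₀ ℓ M aHi Λ θ s) (hB : BareHotSparseBPG ϑ ϑe ωe p r₀ ℓ M aHi Λ θ s) : HotSparseBPG ϑ aHi Λ θ s := by
  intro δ hδ a ha Cg hCg εw hεw K₀ hK₀
  obtain ⟨η₁, hη₁, R₁, hR₁, h1⟩ := hB δ hδ a ha Cg hCg εw hεw K₀ hK₀
  refine ⟨η₁, hη₁, R₁, hR₁, fun S hS hgood η hη hηle R hR L w hLw Ψ hΨ hBI hfat => ?_⟩
  have hdress : ∀ x ∈ atomsIn (μS S) 0 R, IsDressed ϑe ωe p r₀ ℓ M S (LayeredHom (L : E3 →L[ℝ] E3) w) x →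
      IsTameStar ϑ S (LayeredHom (L : E3 →L[ℝ] E3) w) x := by
    intro x _ hx
    obtain ⟨K, hKS, hKf, hxK, hKM, hu⟩ := hx
    exact hI δ hδ a ha S hS hgood L w hLw K hKS hKf hKM hu x hxK
  exact (hotCount_le_bareHotCount (finite_atomsIn hδ hS.1.2.1 R) hdress).trans (h1 S hS hgood η hη hηle R hR L w hLw Ψ hΨ hBI hfat)

/-- **[Tᵇ] ⇒ [HSᵇ] (PROVED)** — the count is zero on `win R ⊆ win 9R`. [this file, g61] -/
theorem hotSparseBPG_of_tameWindowBPG {ϑ aHi Λ θ s : ℝ} (h : TameWindowBPG ϑ aHi Λ θ s) : HotSparseBPG ϑ aHi Λ θ s := by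
  intro δ hδ a ha Cg hCg εw hεw K₀ hK₀
  obtain ⟨η₁, hη₁, R₁, hR₁, h1⟩ := h δ hδ a ha Cg hCg K₀ hK₀
  refine ⟨η₁, hη₁, R₁, hR₁, fun S hS hgood η hη hηle R hR L w hLw Ψ hΨ hBI hfat => ?_⟩
  have hsub : atomsIn (μS S) 0 R ⊆ atomsIn (μS S) 0 (9 * R) := by
    have h' := atomsIn_mono_mul (S := S) (by norm_num : (1 : ℝ) ≤ 9) (hR₁.le.trans hR)
    rwa [one_mul] at h'
  rw [hotCount_eq_zero_of_isTameOn (h1 S hS hgood η hη hηle R hR L w hLw Ψ hΨ hBI hfat) hsub]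
  exact mul_nonneg (mul_nonneg hεw.le hη.le) (nK_nonneg _)

/-- **[T_bᵇ] ⇒ [BHSᵇ] (PROVED)** — the count is zero on `win R ⊆ win 9R`. [this file, g61] -/
theorem bareHotSparseBPG_of_bareTame {ϑ ϑe ωe : ℝ} {p : ℕ} {r₀ ℓ : ℝ} {M : ℕ} {aHi Λ θ s : ℝ}
    (h : BareTameWindowBPG ϑ ϑe ωe p r₀ ℓ M aHi Λ θ s) : BareHotSparseBPG ϑ ϑe ωe p r₀ ℓ M aHi Λ θ s := by
  intro δ hδ a ha Cg hCg εw hεw K₀ hK₀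
  obtain ⟨η₁, hη₁, R₁, hR₁, h1⟩ := h δ hδ a ha Cg hCg K₀ hK₀
  refine ⟨η₁, hη₁, R₁, hR₁, fun S hS hgood η hη hηle R hR L w hLw Ψ hΨ hBI hfat => ?_⟩
  have hsub : atomsIn (μS S) 0 R ⊆ atomsIn (μS S) 0 (9 * R) := by
    have h' := atomsIn_mono_mul (S := S) (by norm_num : (1 : ℝ) ≤ 9) (hR₁.le.trans hR)
    rwa [one_mul] at h'
  rw [bareHotCount_eq_zero_of_bare_tame fun x hx hnd => h1 S hS hgood η hη hηle R hR L w hLw Ψ hΨ hBI hfat x (hsub hx) hnd]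
  exact mul_nonneg (mul_nonneg hεw.le hη.le) (nK_nonneg _)

/-- **[ISᵇ₀] ⇒ [TISᵇ](ϑ) for every `ϑ` (PROVED)** — sub-count. [this file, g61] -/
theorem tameIncoherenceSparseBPG_of_sparse₀ {ϑ₁ ω₁ ϑ aHi Λ θ s : ℝ} (h : IncoherenceSparseBPG₀ ϑ₁ ω₁ aHi Λ θ s) :
    TameIncoherenceSparseBPG ϑ₁ ω₁ ϑ aHi Λ θ s := by
  intro δ hδ a ha Cg hCg εw hεw K₀ hK₀
  obtain ⟨η₁, hη₁, R₁, hR₁, h1⟩ := h δ hδ a ha Cg hCg εw hεw K₀ hK₀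
  exact ⟨η₁, hη₁, R₁, hR₁, fun S hS hgood η hη hηle R hR L w hLw Ψ hΨ hBI hfat =>
    (tameIncoherentCount_le_incoherentCount (finite_atomsIn hδ hS.1.2.1 R)).trans (h1 S hS hgood η hη hηle R hR L w hLw Ψ hΨ hBI hfat)⟩

/-- **THE DOCKET OF RECORD ⇒ THE COUNT DOCKET (PROVED)**: [I_D] ∧ [T_bᵇ] ∧ [W_Ψᵇ₁](ϑ₁, ω₁) at threshold `ϑ` give [BHSᵇ] ∧ [TISᵇ](ϑ₁, ω₁, ϑ). [this file, g61] -/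
theorem bareHotSparse_and_tameIncoherenceSparse_of_record {ϑ₁ ω₁ ϑ ϑe ωe : ℝ} {p : ℕ} {r₀ ℓ : ℝ} {M : ℕ} {aHi Λ θ s : ℝ}
    (hI : DressedCorePG ϑ ϑe ωe p r₀ ℓ M aHi Λ θ s) (hTb : BareTameWindowBPG ϑ ϑe ωe p r₀ ℓ M aHi Λ θ s)
    (hW : CoherentWindowPsiBPG₁ ϑ₁ ω₁ ϑ aHi Λ θ s) :
    BareHotSparseBPG ϑ ϑe ωe p r₀ ℓ M aHi Λ θ s ∧ TameIncoherenceSparseBPG ϑ₁ ω₁ ϑ aHi Λ θ s :=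
  ⟨bareHotSparseBPG_of_bareTame hTb, tameIncoherenceSparseBPG_of_sparse₀ (incoherenceSparseBPG₀_of_dressedCore_coherent₁ hI hTb hW)⟩

/-- (R_Wᵇ) from [I_D] ∧ [BHSᵇ] ∧ [TISᵇ] under the side condition (PROVED). [this file, g61] -/
theorem wildFractionBPG_of_dressedCore_bareHot_tameIncoherent {ϑ₁ ω₁ ϑ ϑe ωe : ℝ} {p : ℕ} {r₀ ℓ : ℝ} {M : ℕ} {aHi Λ θ s : ℝ}
    (hside : 4 * ω₁ + ϑ₁ < tameRadius) (hI : DressedCorePG ϑ ϑe ωe p r₀ ℓ M aHi Λ θ s) (hB : BareHotSparseBPG ϑ ϑe ωe p r₀ ℓ M aHi Λ θ s)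
    (hT : TameIncoherenceSparseBPG ϑ₁ ω₁ ϑ aHi Λ θ s) : WildFractionBPG aHi Λ θ s :=
  wildFractionBPG_of_sparse₀ hside (incoherenceSparseBPG₀_of_hot_tameIncoherent (hotSparseBPG_of_dressedCore_bareHot hI hB) hT)

/-- ★★★ **COLUMN `_16XH22Bᶜ`** — `_16XH21B₁` with the residual trio in COUNT form: [I_D] `DressedCorePG` (kept: finite certificate) ∧ [BHSᵇ] `BareHotSparseBPG`
(bare hot stars `o(η)`-sparse, replacing [T_bᵇ]'s «none») ∧ [TISᵇ] `TameIncoherenceSparseBPG (1/100) (1/200) tameRadius` (tame-but-incoherent stars `o(η)`-sparse,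
replacing [W_Ψᵇ₁]'s «none»).  Each hypothesis is implied by the one it replaces (`bareHotSparse_and_tameIncoherenceSparse_of_record`, PROVED). [this file, g61] -/
theorem gap_and_pert_1_50_of_certs_16XH22Bc (hL : LatticeLiouvilleCert) (hL' : LayeredLiouvilleCert)
    (hR : OscRigidityL2BDPG 1 2 (1 / 16) (1 / 16)) (hX : ExcessFlatnessControlP 1 2 (1 / 16) (1 / 16))
    (hE : ExcessChartLocalisationP 1 2 (1 / 16) (1 / 100)) (hP : RegistrationP 1 2 (1 / 16) (1 / 100))
    (hT : TailDominationCert) (hU : UniformTameStabilityE (1 / 50) 2 (1 / 2000))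
    (h1 : WordTransplantP 1 2 (1 / 16) (1 / 100)) (hGT : GradReframingThickP 1 2 (1 / 16) (1 / 100) (1 / 50))
    (hΛ0 : LaunderingAprioriPX 1 2 (1 / 16) (1 / 100) (1 / 50)) (hΛs : LaunderingStepPX 1 2 (1 / 16) (1 / 100) (1 / 50))
    (hUc : UntwistCollarP 1 2 (1 / 16) (1 / 50))
    (hl : BondIsoLevelsP 1 2 (1 / 16) (1 / 50)) (hN : EnergyNearChartPX 1 2 (1 / 16) (1 / 50) (1 / 2000))
    (hF : TailForceSlavingP 1 2 (1 / 16) (1 / 50))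
    (hE' : LipDualLinearisationP 1 2 (1 / 16) (1 / 50)) (hA : L2HarmonicApproxPE 1 2 (1 / 16) (1 / 50) (1 / 2000))
    (hD : PositionDecayPLE 1 2 (1 / 16) (1 / 50) (1 / 2000)) (hC : PositionCaccioppoliPGE 1 2 (1 / 16) (1 / 50) (1 / 2000))
    (hI : DressedCorePG tameRadius dressLevel dressLevel dressExponent 8 collarRadius clusterSize 1 2 (1 / 16) (1 / 50))
    (hBHS : BareHotSparseBPG tameRadius dressLevel dressLevel dressExponent 8 collarRadius clusterSize 1 2 (1 / 16) (1 / 50))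
    (hTIS : TameIncoherenceSparseBPG (1 / 100) (1 / 200) tameRadius 1 2 (1 / 16) (1 / 50))
    (hG : PeriodicBulkGapDoor 2) : VisibleGap (1 / 50) ∧ PertRegime (1 / 50) :=
  gap_and_pert_1_50_of_certs_16XH18B_tol hL hL' hR hX hE hP hT hU h1 hGT hΛ0 hΛs hUc (untwistBookkeepingP_one 2 (1 / 50)) hl hN hF hE' hA hD hC
    (wildFractionBPG_of_dressedCore_bareHot_tameIncoherent (by norm_num [tameRadius]) hI hBHS hTIS) hG

end Summit.AtomisticToContinuum.Crystallization.Theorems.ChartedZeroExcessLayeredLatticeLiouville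

end
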